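import Mathlib.NumberTheory.NumberField.Cyclotomic.PID
import Mathlib.NumberTheory.NumberField.Cyclotomic.Ideal
import Mathlib.NumberTheory.NumberField.Ideal.KummerDedekind
import Mathlib.RingTheory.Polynomial.Cyclotomic.Expand
import Mathlib.Algebra.Polynomial.SpecificDegree
import Mathlib.Analysis.Real.Pi.Bounds
import Mathlib.Tactic.NormNum.Prime
import Mathlib.Tactic.ComputeDegree
import HarnessLib

/-!
# `ℚ(ζ₂₄)` has class number one: `ℤ[ζ₂₄]` is a principal ideal domain

Topic `Literature/NumberTheory/NumberFields`, namespace `Literature.NumberTheory.NumberFields`.  Theorems only; no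
definition, no named fact (net Literature debt 0).  With `CyclotomicFieldFifteenClassNumber`, `…SixteenClassNumber` (in
`CyclotomicFieldsEightSixteenClassNumber`) and `CyclotomicFieldTwentyClassNumber` this completes the four cyclotomic fields of
degree `8` (`φ(n) = 8 ⟺ n ∈ {15, 16, 20, 24}`), all of class number one (Masley–Montgomery; Washington Thm. 11.1).

`ℚ(ζ₂₄) = ℚ(i, √2, √3)`, degree `8`, `Gal ≅ (ℤ/24)ˣ ≅ C₂³`, discriminant `d = 2¹⁶ · 3⁴ = 5308416 = 2304²`, Minkowski constant
`M_K = (4/π)⁴ · (8!/8⁸) · 2304 ≈ 14.6 < 15`.  The primes `5, 7, 11, 13` have residue degree `2` in `ℚ(ζ₂₄)` (every unit of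
`ℤ/24` has order `≤ 2`), norms `25, 49, 121, 169 > 14`.  The primes above `2` and `3` ALSO have residue degree `2` (`24 = 2³·3`,
`f(2) = ord₃(2) = 2`; `24 = 3·8`, `f(3) = ord₈(3) = 2`), so no reduction to a prime field `𝔽_p` certifies a generator; instead
we use Kummer–Dedekind (Mathlib `NumberField.Ideal.primesOverSpanEquivMonicFactorsMod`, index `[𝓞_K : ℤ[ζ]] = 1`): the
primes above `p` are `(p, Q(ζ))` for the monic irreducible factors `Q` of `Φ₂₄ = X⁸ − X⁴ + 1` modulo `p`, and

* `p = 2`: `Φ₂₄ ≡ (X² + X + 1)⁴ (mod 2)`; the prime `(2, ζ² + ζ + 1)` EQUALS `(ζ² + ζ + 1)` because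
  `(ζ² + ζ + 1)(1 − 2ζ + ζ² + ζ³ − ζ⁴ + ζ⁵ − ζ⁷) = 2` in `ℤ[ζ]` (so `N(ζ² + ζ + 1) = 4`);
* `p = 3`: `Φ₂₄ ≡ (X² + X + 2)(X² + 2X + 2)·… ≡ (X⁴ + 1)² (mod 3)`; the prime `(3, ζ² + ζ + 2)` EQUALS `(1 + ζ + ζ³)` because
  `(1 + ζ + ζ³)(1 − 2ζ² + ζ³ + ζ⁴ + ζ⁶ − 2ζ⁷) = 3`, `(1 + ζ + ζ³)(1 + ζ − ζ² + ζ⁶ − ζ⁷) = ζ² + ζ + 2` and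
  `1 + ζ + ζ³ = (ζ − 1)(ζ² + ζ + 2) + 3` (so `N(1 + ζ + ζ³) = 9`),

all verified by `linear_combination` against `Φ₂₄(ζ) = 0` (`ζ¹² = −1`, `ζ⁴ ≠ −1`).  Mathlib's Galois-case criterion
`RingOfIntegers.isPrincipalIdealRing_of_isPrincipal_of_lt_or_isPrincipal_of_mem_primesOver_of_mem_Icc` concludes.

* `discr_of_isCyclotomicExtension_twentyFour` (`5308416`), `minkowskiBound_lt_fifteen_of_isCyclotomicExtension_twentyFour`,
  `cyclotomic_six_int`, `cyclotomic_twelve_int`, `cyclotomic_twentyFour_int` (`Φ₆ = X² − X + 1`, `Φ₁₂ = X⁴ − X² + 1`,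
  `Φ₂₄ = X⁸ − X⁴ + 1`), `toInteger_pow_eight_sub_eq_zero_twentyFour`,
  **`span_zeta_sq_add_zeta_add_one_mem_primesOver_twentyFour`** (`(ζ² + ζ + 1)` is a prime above `2`),
  **`span_one_add_zeta_add_zeta_pow_three_mem_primesOver_twentyFour`** (`(1 + ζ + ζ³)` is a prime above `3`),
  **`classNumber_eq_one_of_isCyclotomicExtension_twentyFour`**, `isPrincipalIdealRing_adjoin_of_isPrimitiveRoot_twentyFour`,
  `isPrincipalIdealRing_ringOfIntegers_cyclotomicField_twentyFour`, `classNumber_cyclotomicField_twentyFour`.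

## References

* [Washington1997] L. C. Washington, *Introduction to Cyclotomic Fields*, 2nd ed., GTM 83 (1997), Thm. 11.1
  (Masley–Montgomery), Prop. 2.7 (discriminant), Thm. 2.13 and Prop. 2.14 (splitting of primes; Kummer–Dedekind).
* [Marcus2018] D. A. Marcus, *Number Fields*, 2nd ed. (2018), Ch. 3 Thm. 26 and Thm. 27 (chunk p0064), Ch. 5 Thm. 37 Cor. 2 (p0107).
* [MasleyMontgomery1976] J. M. Masley, H. L. Montgomery, *Cyclotomic fields with unique factorization*, J. reine angew.
  Math. 286/287 (1976) 248–256.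
-/

noncomputable section

namespace Literature.NumberTheory.NumberFields

open NumberField NumberField.InfinitePlace Polynomial Nat Real IsCyclotomicExtension.Rat Ideal
open scoped Real

/-! ### The cyclotomic polynomials `Φ₆`, `Φ₁₂`, `Φ₂₄` -/

/-- **`Φ₆ = X² − X + 1`** (from `Φ₃(X²) = Φ₆ Φ₃`). [cite: Washington1997, Ch. 2 (cyclotomic polynomials)] -/
theorem cyclotomic_six_int : cyclotomic 6 ℤ = X ^ 2 - X + 1 := by
  have h := cyclotomic_expand_eq_cyclotomic_mul Nat.prime_two (by norm_num : ¬ 2 ∣ 3) ℤ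
  rw [show (3 * 2 : ℕ) = 6 by norm_num, cyclotomic_three] at h
  have hexp : expand ℤ 2 (X ^ 2 + X + 1 : ℤ[X]) = X ^ 4 + X ^ 2 + 1 := by
    simp [expand_X]
    ring
  rw [hexp] at h
  have hne : (X ^ 2 + X + 1 : ℤ[X]) ≠ 0 := by
    rw [← cyclotomic_three]; exact cyclotomic_ne_zero 3 ℤ
  apply mul_right_cancel₀ hne
  rw [← h]
  ring

/-- **`Φ₁₂ = X⁴ − X² + 1`** (`= Φ₆(X²)`, `2 ∣ 6`). [cite: Washington1997, Ch. 2 (cyclotomic polynomials)] -/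
theorem cyclotomic_twelve_int : cyclotomic 12 ℤ = X ^ 4 - X ^ 2 + 1 := by
  have h := cyclotomic_expand_eq_cyclotomic Nat.prime_two (by norm_num : 2 ∣ 6) ℤ
  rw [show (6 * 2 : ℕ) = 12 by norm_num, cyclotomic_six_int] at h
  rw [← h]
  simp [expand_X]
  ring

/-- **`Φ₂₄ = X⁸ − X⁴ + 1`** (`= Φ₁₂(X²)`, `2 ∣ 12`). [cite: Washington1997, Ch. 2 (cyclotomic polynomials)] -/
theorem cyclotomic_twentyFour_int : cyclotomic 24 ℤ = X ^ 8 - X ^ 4 + 1 := by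
  have h := cyclotomic_expand_eq_cyclotomic Nat.prime_two (by norm_num : 2 ∣ 12) ℤ
  rw [show (12 * 2 : ℕ) = 24 by norm_num, cyclotomic_twelve_int] at h
  rw [← h]
  simp [expand_X]
  ring

section TwentyFour

variable (K : Type) [Field K] [NumberField K] [IsCyclotomicExtension {24} ℚ K]

/-- **The discriminant of `ℚ(ζ₂₄)` is `2¹⁶ · 3⁴ = 5308416`** (`(−1)^{φ(24)/2} 24⁸ / (2^{8/1} 3^{8/2})`). [cite: Washington1997, Prop. 2.7] -/
theorem discr_of_isCyclotomicExtension_twentyFour : NumberField.discr K = 5308416 := by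
  have h := IsCyclotomicExtension.Rat.discr 24 K
  have hφ : Nat.totient 24 = 8 := by decide
  have hpf : (24 : ℕ).primeFactors = {2, 3} := by
    rw [show (24 : ℕ) = 2 ^ 3 * 3 from rfl, Nat.primeFactors_mul (by norm_num) (by norm_num),
      Nat.primeFactors_prime_pow (by norm_num) Nat.prime_two, Nat.Prime.primeFactors Nat.prime_three]
    rfl
  rw [hφ, hpf, Finset.prod_pair (by norm_num)] at h
  rw [h]
  norm_num

/-- **The Minkowski constant of `ℚ(ζ₂₄)` is `< 15`**: `(4/π)⁴ · (8!/8⁸) · √5308416 < (4/3.14)⁴ · (315/131072) · 2304 < 15`.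
[cite: Marcus2018, Ch. 5 Thm. 37 Cor. 2 (p0107)] -/
theorem minkowskiBound_lt_fifteen_of_isCyclotomicExtension_twentyFour :
    (4 / π) ^ nrComplexPlaces K * ((Module.finrank ℚ K)! / (Module.finrank ℚ K) ^ (Module.finrank ℚ K) *
      √|(NumberField.discr K : ℝ)|) < 15 := by
  rw [discr_of_isCyclotomicExtension_twentyFour K, IsCyclotomicExtension.finrank (n := 24) K
    (cyclotomic.irreducible_rat (by norm_num)), nrComplexPlaces_eq_totient_div_two 24,
    show Nat.totient 24 = 8 by decide]
  have hπ : 4 / π < 4 / 3.14 := by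
    apply div_lt_div_of_pos_left (by norm_num) (by norm_num) pi_gt_d2
  have hπ0 : 0 ≤ 4 / π := by positivity
  have h4 : (4 / π) ^ (8 / 2) < (4 / 3.14 : ℝ) ^ (8 / 2) := by
    rw [show (8 / 2 : ℕ) = 4 by norm_num]
    gcongr
  have hsqrt : √|((5308416 : ℤ) : ℝ)| = 2304 := by
    rw [show |((5308416 : ℤ) : ℝ)| = 2304 ^ 2 by norm_num, Real.sqrt_sq (by norm_num)]
  have hfac : ((8 : ℕ)! : ℝ) / (8 : ℕ) ^ (8 : ℕ) = 315 / 131072 := by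
    rw [show (8 : ℕ)! = 40320 by rfl]
    norm_num
  rw [hfac, hsqrt]
  calc (4 / π) ^ (8 / 2) * (315 / 131072 * (2304 : ℝ))
      ≤ (4 / 3.14 : ℝ) ^ (8 / 2) * (315 / 131072 * 2304) := by
        gcongr
    _ < 15 := by norm_num

variable {K} in
omit [NumberField K] [IsCyclotomicExtension {24} ℚ K] in
/-- **`Φ₂₄(ζ) = 0` in `𝓞_K`, spelled out**: `ζ⁸ − ζ⁴ + 1 = 0` for a primitive `24`-th root of unity `ζ` (`ζ¹² = −1`, `ζ⁴ ≠ −1`,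
`X¹² + 1 = (X⁴ + 1) Φ₂₄`). [cite: Washington1997, Ch. 2 (cyclotomic polynomials)] -/
theorem toInteger_pow_eight_sub_eq_zero_twentyFour {ζ : K} (hζ : IsPrimitiveRoot ζ 24) :
    hζ.toInteger ^ 8 - hζ.toInteger ^ 4 + 1 = 0 := by
  set z : 𝓞 K := hζ.toInteger with hz
  have hz' : IsPrimitiveRoot z 24 := hζ.toInteger_isPrimitiveRoot
  have h24 : z ^ 24 = 1 := hz'.pow_eq_one
  have h12 : z ^ 12 ≠ 1 := hz'.pow_ne_one_of_pos_of_lt (by norm_num) (by norm_num)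
  have h8 : z ^ 8 ≠ 1 := hz'.pow_ne_one_of_pos_of_lt (by norm_num) (by norm_num)
  have h12' : z ^ 12 + 1 = 0 := by
    have hprod : (z ^ 12 - 1) * (z ^ 12 + 1) = 0 := by linear_combination h24
    rcases mul_eq_zero.1 hprod with h | h
    · exact absurd (sub_eq_zero.1 h) h12
    · exact h
  have h4 : z ^ 4 + 1 ≠ 0 := by
    intro h
    apply h8
    linear_combination (z ^ 4 - 1) * h
  have hprod : (z ^ 4 + 1) * (z ^ 8 - z ^ 4 + 1) = 0 := by linear_combination h12'
  rcases mul_eq_zero.1 hprod with h | h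
  · exact absurd h h4
  · exact h

variable {K} in
/-- **Kummer–Dedekind for `ℤ[ζ₂₄] = 𝓞_K`**: for a monic irreducible factor `Q̄` of `Φ₂₄ (mod p)` with a lift `Q ∈ ℤ[X]`, the ideal
`(p, Q(ζ))` is a prime of `𝓞_K` above `p` (Mathlib's `primesOverSpanEquivMonicFactorsMod`; the index `[𝓞_K : ℤ[ζ]] = 1`).
[cite: Washington1997, Prop. 2.14] [cite: Marcus2018, Ch. 3 Thm. 27] -/
private theorem span_pair_mem_primesOver₂₄ {ζ : K} (hζ : IsPrimitiveRoot ζ 24) {p : ℕ} [hp : Fact p.Prime] {Q : ℤ[X]}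
    (hQ : Q.map (Int.castRingHom (ZMod p)) ∈ RingOfIntegers.monicFactorsMod hζ.toInteger p) :
    Ideal.span {(p : 𝓞 K), aeval hζ.toInteger Q} ∈ primesOver (span {(p : ℤ)}) (𝓞 K) := by
  have h₁ : ¬ p ∣ RingOfIntegers.exponent hζ.toInteger := by
    rw [RingOfIntegers.exponent_eq_one_iff.mpr <| IsCyclotomicExtension.Rat.adjoin_singleton_eq_top hζ]
    exact hp.out.not_dvd_one
  rw [← NumberField.Ideal.primesOverSpanEquivMonicFactorsMod_symm_apply_eq_span h₁ hQ]
  exact ((NumberField.Ideal.primesOverSpanEquivMonicFactorsMod h₁).symm ⟨_, hQ⟩).prop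

variable {K} in
omit [IsCyclotomicExtension {24} ℚ K] in
/-- The minimal polynomial of `ζ₂₄ ∈ 𝓞_K` over `ℤ`, reduced modulo `p`, is `X⁸ − X⁴ + 1`. [cite: Washington1997, Ch. 2] -/
private theorem map_minpoly_toInteger₂₄ {ζ : K} (hζ : IsPrimitiveRoot ζ 24) (p : ℕ) :
    (minpoly ℤ (hζ.toInteger : 𝓞 K)).map (Int.castRingHom (ZMod p)) = X ^ 8 - X ^ 4 + 1 := by
  rw [← NumberField.RingOfIntegers.minpoly_coe]
  change (minpoly ℤ ζ).map (Int.castRingHom (ZMod p)) = _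
  rw [← cyclotomic_eq_minpoly hζ (by norm_num), cyclotomic_twentyFour_int]
  simp

/-! #### The prime above `2` -/

variable {K} in
omit [IsCyclotomicExtension {24} ℚ K] in
/-- `X² + X + 1` is a monic irreducible factor of `Φ₂₄` modulo `2` (`Φ₂₄ ≡ (X² + X + 1)⁴`; no root in `𝔽₂`).
[cite: Washington1997, Thm. 2.13 and Prop. 2.14] -/
private theorem mem_monicFactorsMod_two₂₄ {ζ : K} (hζ : IsPrimitiveRoot ζ 24) :
    (X ^ 2 + X + 1 : ℤ[X]).map (Int.castRingHom (ZMod 2)) ∈ RingOfIntegers.monicFactorsMod hζ.toInteger 2 := by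
  classical
  have hmap : (X ^ 2 + X + 1 : ℤ[X]).map (Int.castRingHom (ZMod 2)) = X ^ 2 + X + 1 := by simp
  rw [RingOfIntegers.monicFactorsMod, Multiset.mem_toFinset, map_minpoly_toInteger₂₄ hζ 2, hmap]
  have hmonic : (X ^ 2 + X + 1 : (ZMod 2)[X]).Monic := by monicity!
  have hdeg : (X ^ 2 + X + 1 : (ZMod 2)[X]).natDegree = 2 := by compute_degree!
  have hne : (X ^ 8 - X ^ 4 + 1 : (ZMod 2)[X]) ≠ 0 := by
    apply Monic.ne_zero
    monicity!
  refine (Polynomial.mem_normalizedFactors_iff hne).2 ⟨?_, hmonic, ?_⟩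
  · rw [hmonic.irreducible_iff_roots_eq_zero_of_degree_le_three (by omega) (by omega)]
    refine Multiset.eq_zero_of_forall_notMem fun x hx ↦ ?_
    rw [mem_roots hmonic.ne_zero, IsRoot.def] at hx
    fin_cases x <;> simp at hx <;> revert hx <;> decide
  · -- `X⁸ − X⁴ + 1 = (X² + X + 1)(X⁶ − X⁵ + X³ − 2X² + X + 1) − 2X` over `ℤ`
    have h2 : (2 : (ZMod 2)[X]) = 0 := by
      have h0 := CharP.cast_eq_zero (ZMod 2)[X] 2
      simpa using h0
    exact ⟨X ^ 6 - X ^ 5 + X ^ 3 - 2 * X ^ 2 + X + 1, by linear_combination (-X) * h2⟩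

variable {K} in
/-- **THE PRINCIPAL PRIME `(ζ² + ζ + 1)` OF `𝓞_{ℚ(ζ₂₄)}` ABOVE `2`**: it is the Kummer–Dedekind prime `(2, ζ² + ζ + 1)` (factor
`X² + X + 1` of `Φ₂₄ mod 2`, residue degree `2`, the unique prime above `2`), and `2 = (ζ² + ζ + 1)(1 − 2ζ + ζ² + ζ³ − ζ⁴ + ζ⁵ − ζ⁷)`.
[cite: Washington1997, Thm. 2.13 and Prop. 2.14] [cite: Marcus2018, Ch. 3 Thm. 27] -/
theorem span_zeta_sq_add_zeta_add_one_mem_primesOver_twentyFour {ζ : K} (hζ : IsPrimitiveRoot ζ 24) :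
    Ideal.span {hζ.toInteger ^ 2 + hζ.toInteger + 1} ∈ primesOver (span {((2 : ℕ) : ℤ)}) (𝓞 K) := by
  haveI : Fact (Nat.Prime 2) := ⟨Nat.prime_two⟩
  set z : 𝓞 K := hζ.toInteger with hz
  have hΦ : z ^ 8 - z ^ 4 + 1 = 0 := by rw [hz]; exact toInteger_pow_eight_sub_eq_zero_twentyFour hζ
  have h2 : (z ^ 2 + z + 1) * (1 - 2 * z + z ^ 2 + z ^ 3 - z ^ 4 + z ^ 5 - z ^ 7) = 2 := by
    linear_combination (-1 - z) * hΦ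
  have hmem := span_pair_mem_primesOver₂₄ hζ (mem_monicFactorsMod_two₂₄ hζ)
  have haeval : aeval z (X ^ 2 + X + 1 : ℤ[X]) = z ^ 2 + z + 1 := by simp
  rw [← hz, haeval, Nat.cast_ofNat] at hmem
  have heq : Ideal.span {(2 : 𝓞 K), z ^ 2 + z + 1} = Ideal.span {z ^ 2 + z + 1} := by
    apply le_antisymm
    · rw [Ideal.span_le]
      rintro x (rfl | rfl)
      · rw [SetLike.mem_coe, ← h2]
        exact Ideal.mul_mem_right _ _ (Ideal.subset_span rfl)
      · exact Ideal.subset_span rfl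
    · exact Ideal.span_mono (Set.singleton_subset_iff.2 (Or.inr rfl))
  rw [← heq]
  exact hmem

/-! #### The prime above `3` -/

variable {K} in
omit [IsCyclotomicExtension {24} ℚ K] in
/-- `X² + X + 2` is a monic irreducible factor of `Φ₂₄` modulo `3` (`Φ₂₄ ≡ (X⁴ + 1)²`, `X⁴ + 1 ≡ (X² + X + 2)(X² + 2X + 2)`; no root
in `𝔽₃`). [cite: Washington1997, Thm. 2.13 and Prop. 2.14] -/
private theorem mem_monicFactorsMod_three₂₄ {ζ : K} (hζ : IsPrimitiveRoot ζ 24) :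
    (X ^ 2 + X + 2 : ℤ[X]).map (Int.castRingHom (ZMod 3)) ∈ RingOfIntegers.monicFactorsMod hζ.toInteger 3 := by
  classical
  have hmap : (X ^ 2 + X + 2 : ℤ[X]).map (Int.castRingHom (ZMod 3)) = X ^ 2 + X + 2 := by simp
  rw [RingOfIntegers.monicFactorsMod, Multiset.mem_toFinset, map_minpoly_toInteger₂₄ hζ 3, hmap]
  have hmonic : (X ^ 2 + X + 2 : (ZMod 3)[X]).Monic := by monicity!
  have hdeg : (X ^ 2 + X + 2 : (ZMod 3)[X]).natDegree = 2 := by compute_degree!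
  have hne : (X ^ 8 - X ^ 4 + 1 : (ZMod 3)[X]) ≠ 0 := by
    apply Monic.ne_zero
    monicity!
  refine (Polynomial.mem_normalizedFactors_iff hne).2 ⟨?_, hmonic, ?_⟩
  · rw [hmonic.irreducible_iff_roots_eq_zero_of_degree_le_three (by omega) (by omega)]
    refine Multiset.eq_zero_of_forall_notMem fun x hx ↦ ?_
    rw [mem_roots hmonic.ne_zero, IsRoot.def] at hx
    fin_cases x <;> simp at hx <;> revert hx <;> decide
  · -- `X⁸ − X⁴ + 1 = (X² + X + 2)(X⁶ − X⁵ − X⁴ + 3X³ − 2X² − 4X + 8) − 15` over `ℤ`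
    have h3 : (3 : (ZMod 3)[X]) = 0 := by
      have h0 := CharP.cast_eq_zero (ZMod 3)[X] 3
      simpa using h0
    exact ⟨X ^ 6 - X ^ 5 - X ^ 4 + 3 * X ^ 3 - 2 * X ^ 2 - 4 * X + 8, by linear_combination (-5) * h3⟩

variable {K} in
/-- **THE PRINCIPAL PRIME `(1 + ζ + ζ³)` OF `𝓞_{ℚ(ζ₂₄)}` ABOVE `3`**: it is the Kummer–Dedekind prime `(3, ζ² + ζ + 2)` (factor
`X² + X + 2` of `Φ₂₄ mod 3`, residue degree `2`): `3 = (1 + ζ + ζ³)·β`, `ζ² + ζ + 2 = (1 + ζ + ζ³)·γ` and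
`1 + ζ + ζ³ = (ζ − 1)(ζ² + ζ + 2) + 3`. [cite: Washington1997, Thm. 2.13 and Prop. 2.14] [cite: Marcus2018, Ch. 3 Thm. 27] -/
theorem span_one_add_zeta_add_zeta_pow_three_mem_primesOver_twentyFour {ζ : K} (hζ : IsPrimitiveRoot ζ 24) :
    Ideal.span {1 + hζ.toInteger + hζ.toInteger ^ 3} ∈ primesOver (span {((3 : ℕ) : ℤ)}) (𝓞 K) := by
  haveI : Fact (Nat.Prime 3) := ⟨Nat.prime_three⟩
  set z : 𝓞 K := hζ.toInteger with hz
  have hΦ : z ^ 8 - z ^ 4 + 1 = 0 := by rw [hz]; exact toInteger_pow_eight_sub_eq_zero_twentyFour hζ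
  have hβ : (1 + z + z ^ 3) * (1 - 2 * z ^ 2 + z ^ 3 + z ^ 4 + z ^ 6 - 2 * z ^ 7) = 3 := by
    linear_combination (-2 + z - 2 * z ^ 2) * hΦ
  have hγ : (1 + z + z ^ 3) * (1 + z - z ^ 2 + z ^ 6 - z ^ 7) = z ^ 2 + z + 2 := by
    linear_combination (-1 + z - z ^ 2) * hΦ
  have hπ : 1 + z + z ^ 3 = (z - 1) * (z ^ 2 + z + 2) + 3 := by ring
  have hmem := span_pair_mem_primesOver₂₄ hζ (mem_monicFactorsMod_three₂₄ hζ)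
  have haeval : aeval z (X ^ 2 + X + 2 : ℤ[X]) = z ^ 2 + z + 2 := by simp [map_ofNat]
  rw [← hz, haeval, Nat.cast_ofNat] at hmem
  have heq : Ideal.span {(3 : 𝓞 K), z ^ 2 + z + 2} = Ideal.span {1 + z + z ^ 3} := by
    apply le_antisymm
    · rw [Ideal.span_le]
      rintro x (rfl | rfl)
      · rw [SetLike.mem_coe, ← hβ]
        exact Ideal.mul_mem_right _ _ (Ideal.subset_span rfl)
      · rw [SetLike.mem_coe, ← hγ]
        exact Ideal.mul_mem_right _ _ (Ideal.subset_span rfl)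
    · rw [Ideal.span_le, Set.singleton_subset_iff, SetLike.mem_coe, hπ]
      refine Ideal.add_mem _ (Ideal.mul_mem_left _ _ (Ideal.subset_span (Or.inr rfl))) ?_
      exact Ideal.subset_span (Or.inl rfl)
  rw [← heq]
  exact hmem

/-- `𝓞_K` is a principal ideal domain for a `24`-th cyclotomic extension `K/ℚ` (the Minkowski-bound argument; public form:
`classNumber_eq_one_of_isCyclotomicExtension_twentyFour`). [cite: Marcus2018, Ch. 5 Thm. 37 Cor. 2 (p0107) and Ch. 3 Thm. 26 (p0064)]
[cite: Washington1997, Thm. 11.1] -/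
private theorem isPrincipalIdealRing_ringOfIntegers_twentyFour_aux : IsPrincipalIdealRing (𝓞 K) := by
  -- Thm. 26 data (closed terms, before any `Fact (Nat.Prime _)` enters the context): every unit of `ℤ/24` has order `≤ 2`
  have h5 : orderOf (5 : ZMod 24) = 2 :=
    (orderOf_eq_iff (by norm_num)).2 ⟨by decide, fun m hm h0 ↦ by interval_cases m; decide⟩
  have h7 : orderOf (7 : ZMod 24) = 2 :=
    (orderOf_eq_iff (by norm_num)).2 ⟨by decide, fun m hm h0 ↦ by interval_cases m; decide⟩
  have h11 : orderOf (11 : ZMod 24) = 2 :=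
    (orderOf_eq_iff (by norm_num)).2 ⟨by decide, fun m hm h0 ↦ by interval_cases m; decide⟩
  have h13 : orderOf (13 : ZMod 24) = 2 :=
    (orderOf_eq_iff (by norm_num)).2 ⟨by decide, fun m hm h0 ↦ by interval_cases m; decide⟩
  haveI : IsGalois ℚ K := IsCyclotomicExtension.isGalois {24} ℚ K
  have hM := minkowskiBound_lt_fifteen_of_isCyclotomicExtension_twentyFour K
  have hfloor : ⌊(4 / π) ^ nrComplexPlaces K * ((Module.finrank ℚ K)! / (Module.finrank ℚ K) ^ (Module.finrank ℚ K) *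
      √|(NumberField.discr K : ℝ)|)⌋₊ ≤ 14 :=
    Nat.le_of_lt_succ ((Nat.floor_lt (by positivity)).2 hM)
  -- the unramified primes: `p^f > 14` with `f` the order of `p` modulo `24`
  have key : ∀ p : ℕ, p.Prime → ¬ p ∣ 24 →
      ⌊(4 / π) ^ nrComplexPlaces K * ((Module.finrank ℚ K)! / (Module.finrank ℚ K) ^ (Module.finrank ℚ K) *
        √|(NumberField.discr K : ℝ)|)⌋₊ < p ^ orderOf (p : ZMod 24) →
      ∃ P ∈ primesOver (span {(p : ℤ)}) (𝓞 K),
        ⌊(4 / π) ^ nrComplexPlaces K * ((Module.finrank ℚ K)! / (Module.finrank ℚ K) ^ (Module.finrank ℚ K) *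
          √|(NumberField.discr K : ℝ)|)⌋₊ < p ^ P.inertiaDeg ℤ ∨ Submodule.IsPrincipal P := by
    intro p hp hdvd hlt
    haveI : Fact p.Prime := ⟨hp⟩
    obtain ⟨⟨P, hP⟩⟩ := (Ideal.span {(p : ℤ)}).nonempty_primesOver (S := 𝓞 K)
    refine ⟨P, hP, Or.inl ?_⟩
    haveI := hP.1
    haveI := hP.2
    rwa [inertiaDeg_eq_of_not_dvd p K P (m := 24) hdvd]
  have hζ := IsCyclotomicExtension.zeta_spec 24 ℚ K
  apply RingOfIntegers.isPrincipalIdealRing_of_isPrincipal_of_lt_or_isPrincipal_of_mem_primesOver_of_mem_Icc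
  intro p hp hpp
  have hp14 : p ≤ 14 := (Finset.mem_Icc.1 hp).2.trans hfloor
  have hp2 : 2 ≤ p := hpp.two_le
  interval_cases p
  · -- `p = 2`: the prime `(ζ² + ζ + 1)` above `2` is principal
    exact ⟨_, span_zeta_sq_add_zeta_add_one_mem_primesOver_twentyFour hζ, Or.inr ⟨_, rfl⟩⟩
  · -- `p = 3`: the prime `(1 + ζ + ζ³)` above `3` is principal
    exact ⟨_, span_one_add_zeta_add_zeta_pow_three_mem_primesOver_twentyFour hζ, Or.inr ⟨_, rfl⟩⟩
  · norm_num at hpp -- `4`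
  · exact key 5 hpp (by norm_num) (by rw [Nat.cast_ofNat, h5]; omega)
  · norm_num at hpp -- `6`
  · exact key 7 hpp (by norm_num) (by rw [Nat.cast_ofNat, h7]; omega)
  · norm_num at hpp -- `8`
  · norm_num at hpp -- `9`
  · norm_num at hpp -- `10`
  · exact key 11 hpp (by norm_num) (by rw [Nat.cast_ofNat, h11]; omega)
  · norm_num at hpp -- `12`
  · exact key 13 hpp (by norm_num) (by rw [Nat.cast_ofNat, h13]; omega)
  · norm_num at hpp -- `14`

end TwentyFour

/-! ### Class number one, for an arbitrary model `K`, and for Mathlib's `CyclotomicField 24 ℚ` -/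

/-- **EVERY `24`-TH CYCLOTOMIC EXTENSION `K/ℚ` HAS CLASS NUMBER ONE** (`𝓞_K = ℤ[ζ₂₄]` is a principal ideal domain): Minkowski's
bound `M_K < 15`, residue degree `2` for `5, 7, 11, 13`, and the principal Kummer–Dedekind primes `(ζ² + ζ + 1)` above `2` and
`(1 + ζ + ζ³)` above `3`. [cite: Washington1997, Thm. 11.1] [cite: Marcus2018, Ch. 5 Thm. 37 Cor. 2 (p0107), Ch. 3 Thm. 27]
[cite: MasleyMontgomery1976, Main Theorem] -/
theorem classNumber_eq_one_of_isCyclotomicExtension_twentyFour (K : Type) [Field K] [NumberField K]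
    (hK : IsCyclotomicExtension {24} ℚ K) : classNumber K = 1 :=
  (classNumber_eq_one_iff (K := K)).2 (isPrincipalIdealRing_ringOfIntegers_twentyFour_aux K)

/-- **`ℤ[ζ₂₄]` IS A PRINCIPAL IDEAL DOMAIN**: for every primitive `24`-th root of unity `ζ` of a `24`-th cyclotomic extension
`K/ℚ`, the order `ℤ[ζ]` (`= 𝓞_K`) is a principal ideal ring. [cite: Washington1997, Thm. 11.1] [cite: MasleyMontgomery1976, Main Theorem] -/
theorem isPrincipalIdealRing_adjoin_of_isPrimitiveRoot_twentyFour {K : Type} [Field K] [NumberField K]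
    [IsCyclotomicExtension {24} ℚ K] {ζ : K} (hζ : IsPrimitiveRoot ζ 24) :
    IsPrincipalIdealRing (Algebra.adjoin ℤ ({ζ} : Set K)) :=
  haveI := isPrincipalIdealRing_ringOfIntegers_twentyFour_aux K
  IsPrincipalIdealRing.of_surjective hζ.adjoinEquivRingOfIntegers.symm hζ.adjoinEquivRingOfIntegers.symm.surjective

/-- `CyclotomicField 24 ℚ` is a `24`-th cyclotomic extension of `ℚ` (Mathlib instance, recorded as a term). [folklore] -/
private theorem isCyclotomicExtension_cyclotomicField_twentyFour :
    IsCyclotomicExtension {24} ℚ (CyclotomicField 24 ℚ) :=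
  CyclotomicField.isCyclotomicExtension 24 ℚ

/-- **The ring of integers of `CyclotomicField 24 ℚ` (`= ℤ[ζ₂₄]`) is a principal ideal domain.** [cite: Washington1997, Thm. 11.1]
[cite: MasleyMontgomery1976, Main Theorem] -/
theorem isPrincipalIdealRing_ringOfIntegers_cyclotomicField_twentyFour :
    IsPrincipalIdealRing (𝓞 (CyclotomicField 24 ℚ)) :=
  haveI := isCyclotomicExtension_cyclotomicField_twentyFour
  isPrincipalIdealRing_ringOfIntegers_twentyFour_aux (CyclotomicField 24 ℚ)

/-- **`h(ℚ(ζ₂₄)) = 1`.** [cite: Washington1997, Thm. 11.1] [cite: MasleyMontgomery1976, Main Theorem] -/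
theorem classNumber_cyclotomicField_twentyFour : classNumber (CyclotomicField 24 ℚ) = 1 :=
  (classNumber_eq_one_iff (K := CyclotomicField 24 ℚ)).2 isPrincipalIdealRing_ringOfIntegers_cyclotomicField_twentyFour

end Literature.NumberTheory.NumberFields

end
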